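import Summits.QuantumFields.YangMills.Theorems.UnitScaleTiltProp7HSplitDOfY1
import Summits.QuantumFields.YangMills.Theorems.UnitScaleTiltProp7LandauTransversalityRowsY1All
import Summits.QuantumFields.YangMills.Theorems.UnitScaleTiltProp7HSplitDOfPlaqSmall
import HarnessLib

/-!
# Route `UnitScaleTilt`, crux K1 child «MinimiserStabilityRegPr» (stmt-QuantumFields-19200), skeleton v10, stub `stub_existenceMinimalOrbit` (EX), route (α) —
# **«KNIT-FINAL-ALL»: ✓`Prop7HSplitDOfY1.hSplitD_of_Y1` (★w4-20520 g8 ✓p671435, cure (i) of ★★OWNER RULING g28-№6) FOR EVERY MEMBER OF THE FAMILY** — the EX display's row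
# `hSplit′`∕`hSplitD` from the sector residue `hLift` and numeric windows only, with ✓p671435's member ROOM `100·η ≤ 1` (⇔ `L^{K−n} ≥ 100`, violated by the coarsest members of
# `Idx L`) REPLACED by `3·η ≤ 1` (true at EVERY member: `L ≥ 3`, `n < K`) and the two tighter (hS) windows `10¹¹L²e ≤ 1`, `10¹⁴L³ε₀ ≤ 1` replaced by the ALL-MEMBERS windows
# `10¹⁵L²e ≤ 1`, `10¹⁸L³ε₀ ≤ 1` (L-only numerals).  PROOF = ✓p671435 §3's 25 lines with ✓`exists_rowsY1` ↦ ✓`Prop7LandauTransversalityRowsY1All.exists_rowsY1_all` (px16 g4, «Y1-ALL»);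
# the stencil bridge ✓`stencil_bgUnits_eq_exp_conj` and the window ✓`window_of_C₀δ` are ✓p671435's BY NAME.  PURPOSE (EX namer ★w2-19200 g6 FINAL § «`hSplit′[Lift] ↦ ✓p671435`
# member-range descent»; LOCATE-HSPLIT-DESCENT-px16g4 9937fc18): the display's `hSplit[Lift]` row (S19ᴸ :223–282) becomes a FAMILY theorem at the letters of record (next file).

Cell `ym3-torus`, width seat `ym3-torus-px16` (gen 4).  THEOREMS ONLY (0 `def`, 0 `sorry`).  `--supports stmt-QuantumFields-19200 --as helper`, count-neutral.  YM₃ on T³ is a ladder rung (R3), not the Clay problem; nothing here claims the stub, the crux, d = 4 or the mass gap.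
`hLift` IS NECESSARY near symmetric strata (★★OWNER RULING g28-№6, defect №7, #51) — unchanged; it is the `Lift` antecedent of the display.

References: T. Bałaban, CMP 99 (1985) 389–434 [Balaban1985BackgroundPropagators] ((3.3) p.391, (3.13)–(3.15) p.393, (3.19)–(3.23) pp.393–394, (3.114)–(3.115) p.418); CMP 102 (1985) 277–309 [Balaban1985Variational] ((19) p.281, (44)–(51) pp.285–286, (82)–(83) p.290, (112) p.294); CMP 98 (1985) 17–51 [Balaban1985Averaging] ((8)–(11) pp.18–19, (32)–(34) pp.22–23, (97) p.32); CMP 99 (1985) 75–102 [Balaban1985RegularSpaces] (Sect. D pp.89–95, Prop. 7 p.98).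
-/

set_option autoImplicit false

noncomputable section

open scoped InnerProductSpace Matrix.Norms.L2Operator Matrix BigOperators
open Filter Metric NormedSpace

namespace Summit.QuantumFields.YangMills.Theorems.Prop7HSplitDOfY1All

open Literature.Analysis.Calculus.ExpDifferential (ad gSer)
open Literature.MathematicalPhysics.QuantumFieldTheory.Balaban1983to89
open Literature.MathematicalPhysics.QuantumFieldTheory.Balaban1983to89.T3ContinuumYM3Torus
open T4Continuum BlockAveraging
open BlockAveraging (Idx)
open B7Prop1Explicit (U1 treeWord disp)
open B10Eq27TorusAxialLog (holT transl unitsField toUField)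
open B7TransferAnalyticMean (meanCLM)
open B15DeterminingSets (embIter)
open T3LevelShift (siteShift)
open T3PrintedRegularOrbits (sites_eq)
open T3PrintedRegularMinimiser (RegPr)
open T3SectALandauChart (In19 emb15 eta eta_pos bgUnits)
open B11Prop3Model (Dfix)
open B11Eq103H1Complex (SiteL2K BondL2K)
open Summit.QuantumFields.YangMills.Theorems.Prop8Chart (emlIterU)
open Summit.QuantumFields.YangMills.Theorems.Prop7SectET3Transport (periodsT3)
open Summit.QuantumFields.YangMills.Theorems.Prop7SymAvgTwSym (logChartTwS QTwS CmapTwS Chart47T3twS)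
open Summit.QuantumFields.YangMills.Theorems.Prop7SymAvgGL (QSym)
open Summit.QuantumFields.YangMills.Theorems.Prop7SectET3HilbertLetters (W₂ toL2 toL2S DL2 DstarL2 covLapSite)
open Summit.QuantumFields.YangMills.Theorems.Prop7SectET3GaugeProjector (NS)
open Summit.QuantumFields.YangMills.Theorems.Prop7SPrint (IsLandauPrintS)
open Summit.QuantumFields.YangMills.Theorems.Prop7TPrint (nMax19 expHermField)
open Summit.QuantumFields.YangMills.Theorems.Prop7TwistedSliceGaugeOntoSU2 (coe_bgUnits_apply)
open Summit.QuantumFields.YangMills.Theorems.Prop7LandauTransversalityMarginSU2Chart (chartPoint_su2_norm)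
open Summit.QuantumFields.YangMills.Theorems.Prop7HSplitDOfThreeRows (coe_chartPoint norm_chartPoint_lt)
open Summit.QuantumFields.YangMills.Theorems.Prop7HSplitDOfPlaqSmall (hSplitD_of_threeRows_of_plaqSmall)
open T3RegularMinimiser (regThreshold)
open T3SectALandauChart (covGradT)

open Summit.QuantumFields.YangMills.Theorems.Prop7LandauTransversalityRowsY1All (exists_rowsY1_all)
open Summit.QuantumFields.YangMills.Theorems.Prop7HSplitDOfY1 (stencil_bgUnits_eq_exp_conj window_of_C₀δ)

variable (F : T3Family) {n K : ℕ} (h : n ≤ K)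

/-! ## `hSplitD` from `hLift` and windows, every member -/

/-- ★★★ **«KNIT-FINAL-ALL» — `hSplitD` FROM THE SECTOR RESIDUE `hLift` AND NUMERIC WINDOWS ONLY, AT EVERY MEMBER.**  In the (D47) window with the `H`-letters of ✓`hSplitD_of_pairing` (`U₀ ∈ 𝔘_k(ε₀)`, `10⁹L²e ≤ 1`,
`10¹²L³ε₀ ≤ 1`, `hw137`, `‖HY‖ ≤ b‖Y‖`, `H` real, `9C₂ˢbε < 1`, `6ε ≤ eη`, `Chart47T3twS`, `Q(U₀)∘H = id`, `h45L`), `A′` skew-Hermitian traceless in the half ball with `χ(A′) = iX`, `X`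
Hermitian traceless, the gradient row `‖(∇¹_{U₀}X)_{μμ}‖ ≤ eη²` and the chart point `e^{iX}U₀` PLAQUETTE-regular at some `ε₀′` (`10⁷L³ε₀′ ≤ 1`) — NOT the full (19)-size (px16 g4 (C1′): cycle-free at the display) — PLUS the two all-members windows `10¹⁵L²e ≤ 1`, `10¹⁸L³ε₀ ≤ 1`, the member bound `3·η ≤ 1` (every member) and the sector residue `hLift`: for every Fréchet
derivative `D` of `χ` at `A′` and every skew-Hermitian traceless `ξ` with `QSym(e^{iX}U₀)ξ = 0` there are `δ′` skew-Hermitian traceless with `Q(U₀)δ′ = 0`, `IsLandauPrintS U₀ δ′` and `N`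
Hermitian traceless with `ξ(b) = g(ad(−χ(A′)(b)))((Dδ′)(b)) + (iN(b₋) − (e^{iX}U₀)(b)·iN(b₊)·(e^{iX}U₀)(b)⋆)`.  Proof: the three (Y1′) rows (✓`exists_rowsY1_all` at `U′ := e^{iX}U₀`,
`A₁ := χ(A′)`, `c₁ := c₀η⁻³`; `C₀δ ≤ 1∕10`) → ✓`hSplitD_of_threeRows`, the (T)-row re-lettered by §1, the window by §2.  `hLift` is NECESSARY near symmetric strata (★★OWNER RULING g28-№6,
defect №7, #51): without it the conclusion fails at stabiliser jumps inside the chart; this theorem is the ruling's cure (i).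
[cite: Balaban1985Variational, (19) p.281, (44)–(51) pp.285–286, (82)–(83) p.290, Prop. 3 p.289, (112) p.294; Balaban1985BackgroundPropagators, (3.3) p.391, (3.13)–(3.15) p.393, (3.19)–(3.23) pp.393–394, (3.114)–(3.115) p.418; Balaban1985Averaging, (8)–(11) pp.18–19, (32)–(34) pp.22–23, (97) p.32; Balaban1985RegularSpaces, Sect. D pp.89–95, Prop. 7 p.98] -/
theorem hSplitD_of_Y1_all [Fact (0 < (F.L : ℝ))] [Fact (0 < ((F.L : ℝ)⁻¹) ^ (K - n))] {c₀ cB : ℝ} [Fact (0 < c₀)] [Fact (0 < cB)]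
    {ε₀ e b ε : ℝ} (hε₀ : 0 < ε₀) (he : 0 < e) (hWe : 10 ^ 9 * (F.L : ℝ) ^ 2 * e ≤ 1) (hWε : 10 ^ 12 * (F.L : ℝ) ^ 3 * ε₀ ≤ 1)
    (hWe' : 10 ^ 15 * (F.L : ℝ) ^ 2 * e ≤ 1) (hWε' : 10 ^ 18 * (F.L : ℝ) ^ 3 * ε₀ ≤ 1) (hη : 3 * eta F n K ≤ 1)
    (U₀ : GaugeField (F.P K) 0 (Matrix.specialUnitaryGroup (Fin 2) ℂ)) (hreg : RegPr F n K ε₀ U₀)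
    {H : (PBond (F.P n) 0 → Matrix (Fin 2) (Fin 2) ℂ) →ₗ[ℂ] (PBond (F.P K) 0 → Matrix (Fin 2) (Fin 2) ℂ)} (hb : 0 ≤ b) (hHop : ∀ Y, ‖H Y‖ ≤ b * ‖Y‖)
    (hHR : ∀ Y : PBond (F.P n) 0 → Matrix (Fin 2) (Fin 2) ℂ, (∀ c, star (Y c) = -Y c ∧ (Y c).trace = 0) → ∀ b', star (H Y b') = -H Y b' ∧ (H Y b').trace = 0)
    (hq : 9 * (40 * (2 * (3 * (2 * e + 2700 * (F.L : ℝ) * ε₀))) / (e * eta F n K) ^ 2) * b * ε < 1) (hRε : 6 * ε ≤ e * eta F n K)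
    (h47 : Chart47T3twS F n K h (40 * (2 * (3 * (2 * e + 2700 * (F.L : ℝ) * ε₀))) / (e * eta F n K) ^ 2) ε U₀ H) (hQH : ∀ X, QTwS F n K h U₀ (H X) = X)
    (h45L : ∀ Y, IsLandauPrintS F n K h c₀ cB U₀ (H Y))
    {A' : PBond (F.P K) 0 → Matrix (Fin 2) (Fin 2) ℂ} (hA' : 2 * ‖A'‖ < ε) (hA'R : ∀ b', star (A' b') = -A' b' ∧ (A' b').trace = 0)
    {X : PBond (F.P K) 0 → Matrix (Fin 2) (Fin 2) ℂ} (hX : ∀ b, (X b).IsHermitian ∧ (X b).trace = 0)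
    (hAX : A' - H (Dfix (CmapTwS F n K h U₀) H (40 * (2 * (3 * (2 * e + 2700 * (F.L : ℝ) * ε₀))) / (e * eta F n K) ^ 2) A') = fun b' => Complex.I • X b')
    (hX1 : ∀ (μ : Fin 3) (x : Site (F.P K) 0), ‖covGradT 1 (bgUnits F K U₀) X μ μ x‖ ≤ e * eta F n K ^ 2)
    {ε₀' : ℝ} (hε₀' : 0 < ε₀') (hε' : 10 ^ 7 * (F.L : ℝ) ^ 3 * ε₀' ≤ 1) (hplaq' : PlaqSmall (regThreshold F n K ε₀') (emb15 U₀ (expHermField X)))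
    (hLift : ∀ cf : Site (F.P K) (K - n) → Matrix (Fin 2) (Fin 2) ℂ,
      (∀ e' : PBond (F.P K) (K - n), cf e'.src = ((emlIterU (K - n) (bgUnits F K U₀) e' : (Matrix (Fin 2) (Fin 2) ℂ)ˣ) : Matrix (Fin 2) (Fin 2) ℂ) * cf e'.tgt *
        (((emlIterU (K - n) (bgUnits F K U₀) e')⁻¹ : (Matrix (Fin 2) (Fin 2) ℂ)ˣ) : Matrix (Fin 2) (Fin 2) ℂ)) →
      ∃ l₀ : Site (F.P K) 0 → Matrix (Fin 2) (Fin 2) ℂ,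
        (∀ b' : PBond (F.P K) 0, l₀ b'.src = ((bgUnits F K U₀ b' : (Matrix (Fin 2) (Fin 2) ℂ)ˣ) : Matrix (Fin 2) (Fin 2) ℂ) * l₀ b'.tgt * (((bgUnits F K U₀ b')⁻¹ : (Matrix (Fin 2) (Fin 2) ℂ)ˣ) : Matrix (Fin 2) (Fin 2) ℂ)) ∧
        ∀ y : Site (F.P K) (K - n), l₀ (embIter (K - n) y) = cf y) :
    ∀ D : (PBond (F.P K) 0 → Matrix (Fin 2) (Fin 2) ℂ) →L[ℂ] (PBond (F.P K) 0 → Matrix (Fin 2) (Fin 2) ℂ),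
      HasFDerivAt (fun A : PBond (F.P K) 0 → Matrix (Fin 2) (Fin 2) ℂ =>
        A - H (Dfix (CmapTwS F n K h U₀) H (40 * (2 * (3 * (2 * e + 2700 * (F.L : ℝ) * ε₀))) / (e * eta F n K) ^ 2) A)) D A' →
      ∀ ξ : PBond (F.P K) 0 → Matrix (Fin 2) (Fin 2) ℂ, (∀ b', star (ξ b') = -ξ b' ∧ (ξ b').trace = 0) →
      QSym F n K h (emb15 U₀ (expHermField X)) ξ = 0 →
      ∃ δ' : PBond (F.P K) 0 → Matrix (Fin 2) (Fin 2) ℂ, (∀ b', star (δ' b') = -δ' b' ∧ (δ' b').trace = 0) ∧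
        (QTwS F n K h U₀ δ' = 0 ∧ IsLandauPrintS F n K h c₀ cB U₀ δ') ∧
        ∃ N : Site (F.P K) 0 → Matrix (Fin 2) (Fin 2) ℂ, (∀ x, (N x).IsHermitian ∧ (N x).trace = 0) ∧
          ∀ b' : PBond (F.P K) 0, ξ b' =
            gSer ℂ (ad ℂ (-(A' - H (Dfix (CmapTwS F n K h U₀) H (40 * (2 * (3 * (2 * e + 2700 * (F.L : ℝ) * ε₀))) / (e * eta F n K) ^ 2) A')) b'))
              ((D δ') b')
            + (Complex.I • N b'.src - ((emb15 U₀ (expHermField X) b' : Matrix.specialUnitaryGroup (Fin 2) ℂ) : Matrix (Fin 2) (Fin 2) ℂ) * (Complex.I • N b'.tgt)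
                * star ((emb15 U₀ (expHermField X) b' : Matrix.specialUnitaryGroup (Fin 2) ℂ) : Matrix (Fin 2) (Fin 2) ℂ)) := by
  have hη0 : 0 < eta F n K := eta_pos F n K
  -- the chart point and its three antecedents
  set A₁ : PBond (F.P K) 0 → Matrix (Fin 2) (Fin 2) ℂ :=
    A' - H (Dfix (CmapTwS F n K h U₀) H (40 * (2 * (3 * (2 * e + 2700 * (F.L : ℝ) * ε₀))) / (e * eta F n K) ^ 2) A') with hA₁def
  have hA'1 : ‖A'‖ < ε := by linarith [norm_nonneg A']
  obtain ⟨hA₁, hA₁R, -⟩ := chartPoint_su2_norm F h hε₀ he hWe hWε U₀ hreg hb hHop hHR hq hRε h47 hA'1 hA'R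
  have hU' : ∀ b', ((emb15 U₀ (expHermField X) b' : Matrix.specialUnitaryGroup (Fin 2) ℂ) : Matrix (Fin 2) (Fin 2) ℂ) =
      exp (A₁ b') * ((U₀ b' : Matrix.specialUnitaryGroup (Fin 2) ℂ) : Matrix (Fin 2) (Fin 2) ℂ) := coe_chartPoint F U₀ hX hAX
  -- the (Y1′) rows (ROW-V's `V` is obtained inside ✓`exists_rowsY1`)
  haveI : Fact (0 < c₀ * (eta F n K)⁻¹ ^ 3) := ⟨by have : (0 : ℝ) < c₀ := Fact.out; positivity⟩
  obtain ⟨Kop, C₀, δ, hC₀, hδ, hCδ, hT, hQ4, hKT⟩ :=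
    exists_rowsY1_all F h (c₀ := c₀) (c₁ := c₀ * (eta F n K)⁻¹ ^ 3) rfl cB hε₀ he hWe hWε hWe' hWε' hε₀' hε' hη U₀ (emb15 U₀ (expHermField X)) hreg hplaq' A₁ hA₁ hU'
  -- the window and the (T)-row in the door's stencil letters
  have hwin := window_of_C₀δ F he.le hWe hC₀ hδ hCδ
  have hT' : ∀ (N' : Site (F.P K) 0 → Matrix (Fin 2) (Fin 2) ℂ) (w : PBond (F.P K) 0 → Matrix (Fin 2) (Fin 2) ℂ),
      (∀ b', gSer ℂ (ad ℂ (-A₁ b')) (w b') =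
        N' b'.src - exp (A₁ b') * (((U₀ b' : Matrix.specialUnitaryGroup (Fin 2) ℂ) : Matrix (Fin 2) (Fin 2) ℂ) * N' b'.tgt
          * star ((U₀ b' : Matrix.specialUnitaryGroup (Fin 2) ℂ) : Matrix (Fin 2) (Fin 2) ℂ)) * exp (-A₁ b')) →
      Kop N' = 0 → fderiv ℂ (logChartTwS F n K h U₀) A₁ w = 0 := fun N' w hw hK =>
    hT N' w (fun b' => by rw [hw b', ← stencil_bgUnits_eq_exp_conj F U₀ (emb15 U₀ (expHermField X)) A₁ hA₁R hU' (N' b'.tgt) b']) hK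
  exact hSplitD_of_threeRows_of_plaqSmall F h hε₀ he hWe hWε U₀ hreg hb hHop hHR hq hRε h47 hQH h45L hA' hA'R hX hAX hX1 hε₀' hε' hplaq' hLift (⇑Kop)
    (fun m => ‖toL2S F n (c₀ * (eta F n K)⁻¹ ^ 3) (fun y' : Site (F.P n) 0 => m (siteShift (sites_eq F n K h) y'))‖) (fun a b' => map_sub Kop a b') hC₀ hδ hwin hT' hQ4 hKT

end Summit.QuantumFields.YangMills.Theorems.Prop7HSplitDOfY1All

end
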